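import Summits.QuantumFields.BalabanUV.T4Continuum.Support.NE7ExactLiftComposites
import Summits.QuantumFields.BalabanUV.T4Continuum.Support.NE7CurvedPushDefectLetter
import Summits.QuantumFields.BalabanUV.T4Continuum.Support.NE7SliceRepHessianFloor
import Summits.QuantumFields.BalabanUV.T4Continuum.Support.NE3QuadRemainderTower
import HarnessLib

/-!
# NE7CurvedExactLift — THE EXACT ONE-STEP LIFT AT A CURVED SMALL-FIELD BACKGROUND: **`r_W := r − R₀^W(cpush_W(r ·) − ·)`** (`r` = ✓ `exactLift`, `R₀^W` = ✓ `rightInvW0`, row NE3 ∕ gen 104),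
# **`cpush L W (r_W w) = w` EXACTLY**, skew and periodic, and (at `d = 4`, `L = 2`) **`√dirSq (r_W w − r w) [0,2N)⁴ ≤ etaW(x, b)·√dirSq w [0,N)⁴`** with `etaW` LINEAR in the
# plaquette radius `x` and the BONDWISE radius `b` of `W` — the perturbation letter that ✓ `NE7PerturbedComposites` turns into composite letters with the ratio `ρ` unchanged
# (lineage `b2b-balaban-t4-ne7b-p1`, gen 163; route (H′), memo `t4/b2b-balaban-t4-ne7b-p1/g163/records/SCOPING-R4.md` §3, file (R4c))

Cell `pub-balaban`, rung (B)+1 sub-cell t4, lineage `b2b-balaban-t4-ne7b-p1` (row NE7b OWNER + CRUX PROVER; junction service for row NE7 on ROAD-G116 §6 (G3) ∕ the ℓ² route to (G′)),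
generation 163.
WHY.  The one-level slice step (✓ `NE7OneLevelSliceStep.exists_sliceStep`) needs an EXACT right inverse of `cpush L W` at the curved tower background; the flat lift `r` is exact only for
`cpush L 1` and the defect `cpush_W(r w) − w = (cpush_W − cpush_1)(r w)` is `O(x + b)` in `ℓ²` (✓ `NE7CurvedPushDefectLetter`, NOT `O(x)`: memo §1).  Correcting the defect with row NE3's
exact covariant right inverse `R₀^W` (✓ `dirIter_rightInvW0`, class letter ✓ `dirSq_rightInvW0_class_le`) gives an exact lift whose distance to `r` is `O(x + b)·‖w‖`; no gauge fixing
inside the construction (the bondwise radius `b` is a displayed hypothesis, memo §4).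
WHAT ([folklore]; DATA defs `defect`, `curvedLift`, `etaW`; 0 sorry):
§1 (every `d`, `M`, `N`) skewness of the flat lift: `stencilInvList_mem`, `stencilInv_mem`, `isSkewDir_binv`, `theta_skew`, `isSkewDir_liftDatum`, **`isSkewDir_exactLift`**;
§2 (every `d ≥ 1`, class at one level: `L ≥ 2`, `W` unitary, `LevelSmall d L 0 x`, `SmallField W x`, `cruxC·L²x < 1`, the `hE`-line) `defect`, `isSkewDir_defect`, `isPeriodicDir_defect`,
   **`curvedLift`**, **`cpush_curvedLift`** (`= w` for `W` `(L·N)`-periodic, `w` skew `N`-periodic), `isSkewDir_curvedLift`, `isPeriodicDir_curvedLift`;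
§3 (`d = 4`, `L = 2`) **`dirSq_curvedLift_sub_exactLift_le`** and the root form **`sqrt_dirSq_curvedLift_sub_exactLift_le`**: `√dirSq (r_W w − r w) [0,2N)⁴ ≤ etaW x b·√dirSq w [0,N)⁴`,
   `etaW x b = 2·√liftMassC·√defC·(defA·x + defB·b)·(Kmain + Dgauge)·ρ`.
WHAT IS NOT HERE: the composites of `r_{W_i}` along the tower ((R4d): ✓ `NE7PerturbedComposites` + (C)), the curved one-step curl letter, (K), (G3).
HONEST FRAMING (page 1): composition of kernel theorems about OUR lift and row NE3's right inverse; the bondwise radius `b` is DISPLAYED, not discharged; nothing of Bałaban's asserted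
([Balaban1985Averaging] (42), (47)–(48) context only); NOT (G3), NOT (G′), NOT NE7∕NE3 as spine nodes; row NE7b NOT PRINTED ∕ NOT PROVED; spine 0∕9; finite T⁴ rung (B)+1 — NOT infinite volume,
NOT mass gap, NOT BetaPertH, NOT Clay.
-/

set_option autoImplicit false

open scoped BigOperators Matrix Matrix.Norms.L2Operator
open Finset

namespace Summit.QuantumFields.BalabanUV.T4Continuum.NE7CurvedExactLift

open Literature.MathematicalPhysics.QuantumFieldTheory.Balaban1983to89
open B7Prop1Explicit B7Prop2Explicit
open T4AveragingDeficitWall (IsUnitaryCfg IsSkewDir SmallField dirSq)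
open T4AveragingDeficitWallBoundary (IsPeriodicCfg periodBox)
open AveragingDeficitPeriodicCounting (IsPeriodicDir)
open AveragingDeficitTwoLevelPrep (prop1Radius)
open AveragingDeficitMultiLevelPrep (cpush tower LevelSmall isPeriodicDir_cpush)
open BlockAveragePushDirGauge (gaugeDir)
open MinimalActionWitness (flatCfg)
open SpreadLift (loopRad)
open NE3QbarIterCovLiftPrep (cruxC)
open NE3RightInverseSolveLetters (thetaLoc)
open NE3TangentCovariantTower (dirIter step_small)
open NE3TangentFlatPush (gaugeDir_flatCfg)
open NE3FrameFreeDecompositionPrep (Fhat_mem_skewAdjoint)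
open NE3QuadRemainderTower (cpush_skew)
open NE3EnergyHessContTwoTerm (dirSq_nonneg)
open SmoothRefineInterp (interp interp_mem)
open NE7StencilInverse (stencilInv1 stencilInvList stencilInv stencilInvList_cons)
open NE7WhitneyLiftFlat (isSkewDir_whitneyLift)
open NE7OneLevelSliceStep (cpush_sub_fun dirSq_neg)
open NE7FrameFreeRightInverse (rightInvW0 dirIter_rightInvW0 isSkewDir_rightInvW0 isPeriodicDir_rightInvW0)
open NE7SliceRepHessianFloor (liftMassC liftMassC_nonneg dirSq_rightInvW0_class_le)
open NE7ExactLiftGaugePart (wlift binv theta exactLift cpush_exactLift exactLift_periodic)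
open NE7ExactLiftComposites (liftIter rho rho_nonneg Kmain Dgauge Kmain_nonneg Dgauge_nonneg dirSq_liftIter_le sqrt_le_of_le_sq_mul)
open NE7CurvedPushDefectLetter (defA defB defC defA_nonneg defB_nonneg defC_nonneg dirSq_cpush_sub_cpush_flat_le)

noncomputable section

variable {d : ℕ} {n : Type*} [Fintype n] [DecidableEq n]

/-! ## §1 The flat lift preserves skewness -/

section Skew

variable {X : Type*} [AddCommGroup X] [Module ℝ X]

omit [Fintype n] [DecidableEq n] in
/-- The iterated stencil inverse stays in any `ℝ`-stable additive subgroup. [folklore] -/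
theorem stencilInvList_mem (K : AddSubgroup X) (hK : ∀ (r : ℝ) (x : X), x ∈ K → r • x ∈ K) (l : List (Fin d)) (N : ℕ) (a b : ℝ) :
    ∀ {G : Site d → X}, (∀ x, G x ∈ K) → ∀ y, stencilInvList l N a b G y ∈ K := by
  induction l with
  | nil => intro G hG y; exact hG y
  | cons i l ih =>
      intro G hG y
      rw [stencilInvList_cons]
      simp only [stencilInv1]
      exact hK _ _ (AddSubgroup.sum_mem _ fun k _ => hK _ _ (ih hG _))

omit [Fintype n] [DecidableEq n] in
/-- `stencilInv` stays in any `ℝ`-stable additive subgroup. [folklore] -/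
theorem stencilInv_mem (K : AddSubgroup X) (hK : ∀ (r : ℝ) (x : X), x ∈ K → r • x ∈ K) (N : ℕ) (c : ℝ) {G : Site d → X} (hG : ∀ x, G x ∈ K) (y : Site d) :
    stencilInv N c G y ∈ K :=
  stencilInvList_mem K hK _ N _ _ hG y

end Skew

omit [Fintype n] [DecidableEq n] in
/-- `B_c⁻¹` of a skew 1-form is skew. [folklore] -/
theorem isSkewDir_binv (M N : ℕ) {w : Site d → Fin d → Matrix n n ℂ} (hw : IsSkewDir w) : IsSkewDir (binv M N w) := fun x κ =>
  stencilInv_mem (skewAdjoint (Matrix n n ℂ)) (fun r _ hX => skewAdjoint.smul_mem r hX) N _ (fun x' => hw x' κ) x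

/-- The frame datum of a skew 1-form is skew. [folklore] -/
theorem theta_skew (M : ℕ) {φ : Site d → Fin d → Matrix n n ℂ} (hφ : IsSkewDir φ) (y : Site d) : theta M φ y ∈ skewAdjoint (Matrix n n ℂ) :=
  Fhat_mem_skewAdjoint M (isSkewDir_whitneyLift M hφ) _

/-- The corrected datum `B_c⁻¹w − gaugeDir_1 Θ B_c⁻¹w` of a skew 1-form is skew. [folklore] -/
theorem isSkewDir_liftDatum (M N : ℕ) {w : Site d → Fin d → Matrix n n ℂ} (hw : IsSkewDir w) :
    IsSkewDir (fun x κ => binv M N w x κ - gaugeDir (flatCfg (d := d) (n := n)) (theta M (binv M N w)) x κ) := fun x κ => by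
  refine (skewAdjoint (Matrix n n ℂ)).sub_mem (isSkewDir_binv M N hw x κ) ?_
  rw [gaugeDir_flatCfg]
  exact (skewAdjoint (Matrix n n ℂ)).sub_mem (theta_skew M (isSkewDir_binv M N hw) x) (theta_skew M (isSkewDir_binv M N hw) _)

/-- **THE EXACT FLAT LIFT OF A SKEW 1-FORM IS SKEW.** [folklore] -/
theorem isSkewDir_exactLift (M N : ℕ) {w : Site d → Fin d → Matrix n n ℂ} (hw : IsSkewDir w) : IsSkewDir (exactLift M N w) :=
  isSkewDir_whitneyLift M (isSkewDir_liftDatum M N hw)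

/-! ## §2 The curved exact lift at a one-level class background -/

section Curved

variable [Nonempty n] {L : ℕ} (hL : 2 ≤ L) {W : Site d → Fin d → (Matrix n n ℂ)ˣ} {x : ℝ} (hWu : IsUnitaryCfg W) (hx : 0 ≤ x) (hs : LevelSmall d L 0 x)
  (hWx : SmallField W x) (N : ℕ) [NeZero N] (hθ : cruxC d L * (((L : ℝ) ^ (0 + 1)) ^ 2 * x) < 1)
  (hE : 4 * (d : ℝ) ^ 2 * ((L : ℝ) ^ (0 + 1) - 1) ^ 2 * x + 16 * d * loopRad d L ((prop1Radius d L)^[0] x) ≤ 1 / 2)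

/-- **THE DEFECT** of the flat lift at the curved background: `δ_W w := cpush L W (r w) − w = (cpush_W − cpush_1)(r w)`. [folklore] -/
def defect (w : Site d → Fin d → Matrix n n ℂ) : Site d → Fin d → Matrix n n ℂ := fun z κ => cpush L W (exactLift L N w) z κ - w z κ

omit [NeZero N] in
include hL hWu hx hs hWx in
/-- The defect of a skew datum is skew. [folklore] -/
theorem isSkewDir_defect {w : Site d → Fin d → Matrix n n ℂ} (hw : IsSkewDir w) : IsSkewDir (defect (L := L) (W := W) N w) := by
  have hL1 : 1 ≤ L := by omega
  obtain ⟨h512, -, -, -⟩ := step_small hL1 hWu hx hs.two hWx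
  intro z κ
  exact (skewAdjoint (Matrix n n ℂ)).sub_mem (cpush_skew hL1 hWu hx h512 hWx (isSkewDir_exactLift L N hw) z κ) (hw z κ)

omit [Nonempty n] [NeZero N] in
/-- The defect of an `N`-periodic datum at an `(L·N)`-periodic background is `N`-periodic (`L ≥ 1`). [folklore] -/
theorem isPeriodicDir_defect (hL1 : 1 ≤ L) (hWP : IsPeriodicCfg W ((L : ℤ) * N)) {w : Site d → Fin d → Matrix n n ℂ} (hwP : IsPeriodicDir w (N : ℤ)) :
    IsPeriodicDir (defect (L := L) (W := W) N w) (N : ℤ) := by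
  intro y i κ
  have hrP : IsPeriodicDir (exactLift L N w) ((L : ℤ) * N) := fun z j κ' => by
    have h := exactLift_periodic hL1 N (fun y' j' κ'' => hwP y' j' κ'') z j κ'
    rw [show (((L * N : ℕ) : ℤ)) = (L : ℤ) * N by push_cast; ring] at h
    exact h
  simp only [defect, isPeriodicDir_cpush L N hWP hrP y i κ, hwP y i κ]

/-- **THE CURVED EXACT LIFT** `r_W w := r w − R₀^W(δ_W w)` (for a skew datum `w`; `R₀^W` = ✓ `rightInvW0` at one level). [folklore] -/
def curvedLift {w : Site d → Fin d → Matrix n n ℂ} (hw : IsSkewDir w) : Site d → Fin d → Matrix n n ℂ :=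
  fun y ν => exactLift L N w y ν - rightInvW0 hL 0 hWu hx hs hWx N hθ hE (isSkewDir_defect hL hWu hx hs hWx N hw) y ν

/-- **EXACTNESS AT THE CURVED BACKGROUND**: `cpush L W (r_W w) = w` for `W` `(L·N)`-periodic and `w` skew `N`-periodic (`d ≥ 1`). [folklore] -/
theorem cpush_curvedLift (hd : 0 < d) (hWP : IsPeriodicCfg W ((tower L N (0 + 1) : ℕ) : ℤ)) {w : Site d → Fin d → Matrix n n ℂ} (hw : IsSkewDir w)
    (hwP : IsPeriodicDir w (N : ℤ)) : cpush L W (curvedLift hL hWu hx hs hWx N hθ hE hw) = w := by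
  have hL1 : 1 ≤ L := by omega
  have hWP' : IsPeriodicCfg W ((L : ℤ) * N) := by
    have h : (((tower L N (0 + 1) : ℕ) : ℤ)) = (L : ℤ) * N := by simp [tower]
    rw [h] at hWP; exact hWP
  have hδP := isPeriodicDir_defect N hL1 hWP' hwP
  have hR := dirIter_rightInvW0 hL 0 hWu hx hs hWx N hθ hE (isSkewDir_defect hL hWu hx hs hWx N hw) hWP hδP ⟨0, hd⟩
  -- `dirIter L 1 W = cpush L W`
  have hR' : cpush L W (rightInvW0 hL 0 hWu hx hs hWx N hθ hE (isSkewDir_defect hL hWu hx hs hWx N hw)) = defect (L := L) (W := W) N w := hR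
  unfold curvedLift
  rw [cpush_sub_fun hL1 hWu hx hs hWx, hR']
  funext z κ
  simp only [defect]
  abel

include hL hWu hx hs hWx in
/-- The curved exact lift of a skew datum is skew. [folklore] -/
theorem isSkewDir_curvedLift {w : Site d → Fin d → Matrix n n ℂ} (hw : IsSkewDir w) : IsSkewDir (curvedLift hL hWu hx hs hWx N hθ hE hw) := fun y ν =>
  (skewAdjoint (Matrix n n ℂ)).sub_mem (isSkewDir_exactLift L N hw y ν) (isSkewDir_rightInvW0 hL 0 hWu hx hs hWx N hθ hE _ y ν)

/-- The curved exact lift of an `N`-periodic datum is `(L·N)`-periodic. [folklore] -/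
theorem isPeriodicDir_curvedLift (hWP : IsPeriodicCfg W ((tower L N (0 + 1) : ℕ) : ℤ)) {w : Site d → Fin d → Matrix n n ℂ} (hw : IsSkewDir w)
    (hwP : IsPeriodicDir w (N : ℤ)) : IsPeriodicDir (curvedLift hL hWu hx hs hWx N hθ hE hw) ((tower L N (0 + 1) : ℕ) : ℤ) := by
  have hL1 : 1 ≤ L := by omega
  have ht : (((tower L N (0 + 1) : ℕ) : ℤ)) = (((L * N : ℕ) : ℤ)) := by simp [tower]
  intro y i ν
  have h1 := exactLift_periodic hL1 N (fun y' j' κ'' => hwP y' j' κ'') y i ν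
  have h2 := isPeriodicDir_rightInvW0 hL 0 hWu hx hs hWx N hθ hE (isSkewDir_defect hL hWu hx hs hWx N hw) hWP y i ν
  rw [ht] at h2 ⊢
  simp only [curvedLift, h1, h2]

end Curved

/-! ## §3 The perturbation letter at `d = 4`, `L = 2` -/

section Letter

variable [Nonempty n] {W : Site 4 → Fin 4 → (Matrix n n ℂ)ˣ} {x : ℝ} (hWu : IsUnitaryCfg W) (hx : 0 ≤ x) (hs : LevelSmall 4 2 0 x)
  (hWx : SmallField W x) (N : ℕ) [NeZero N] (hθ : cruxC 4 2 * ((((2 : ℕ) : ℝ) ^ (0 + 1)) ^ 2 * x) < 1)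
  (hE : 4 * ((4 : ℕ) : ℝ) ^ 2 * (((2 : ℕ) : ℝ) ^ (0 + 1) - 1) ^ 2 * x + 16 * (4 : ℕ) * loopRad 4 2 ((prop1Radius 4 2)^[0] x) ≤ 1 / 2)

/-- **THE PERTURBATION CONSTANT** `etaW x b = 2·√liftMassC·√defC·(defA·x + defB·b)·(Kmain + Dgauge)·ρ` — linear in the plaquette radius `x` and in the bondwise radius `b`. [folklore] -/
def etaW (n : Type*) [Fintype n] (x b : ℝ) : ℝ :=
  2 * Real.sqrt (liftMassC 4 2) * Real.sqrt (defC 4 2) * (defA 4 2 * x + defB 4 2 * b) * (Kmain n + Dgauge n) * rho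

omit [DecidableEq n] [Nonempty n] in
/-- `0 ≤ etaW x b` for `x, b ≥ 0`. [folklore] -/
theorem etaW_nonneg {x b : ℝ} (hx : 0 ≤ x) (hb : 0 ≤ b) : 0 ≤ etaW n x b := by
  unfold etaW
  have := liftMassC_nonneg 4 2; have := defA_nonneg 4 2; have := defB_nonneg 4 2; have := Kmain_nonneg (n := n); have := Dgauge_nonneg (n := n); have := rho_nonneg
  positivity

/-- **THE PERTURBATION LETTER, SQUARED** (`d = 4`, `L = 2`; `W` `(2N)`-periodic, `thetaLoc·4x ≤ ½`, `4x ≤ 1`, bondwise radius `b`; `w` skew `N`-periodic):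
`dirSq (r_W w − r w) [0,2N)⁴ ≤ etaW(x,b)²·dirSq w [0,N)⁴`. [folklore] -/
theorem dirSq_curvedLift_sub_exactLift_le (hWP : IsPeriodicCfg W ((tower 2 N (0 + 1) : ℕ) : ℤ))
    (hθl2 : thetaLoc 4 2 * ((((2 : ℕ) : ℝ) ^ (0 + 1)) ^ 2 * x) ≤ 1 / 2) (hε : (((2 : ℕ) : ℝ) ^ (0 + 1)) ^ 2 * x ≤ 1)
    {b : ℝ} (hb : 0 ≤ b) (hWb : ∀ (y : Site 4) (μ : Fin 4), ‖((W y μ : (Matrix n n ℂ)ˣ) : Matrix n n ℂ) - 1‖ ≤ b)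
    {w : Site 4 → Fin 4 → Matrix n n ℂ} (hw : IsSkewDir w) (hwP : IsPeriodicDir w (N : ℤ)) :
    dirSq (fun y ν => curvedLift (by norm_num) hWu hx hs hWx N hθ hE hw y ν - exactLift 2 N w y ν) (periodBox (d := 4) (2 * N))
      ≤ etaW n x b ^ 2 * dirSq w (periodBox (d := 4) N) := by
  have hN : 1 ≤ N := Nat.one_le_iff_ne_zero.mpr (NeZero.ne N)
  obtain ⟨h512, -, -, -⟩ := step_small (d := 4) (by norm_num : 1 ≤ 2) hWu hx hs.two hWx
  have hWP' : IsPeriodicCfg W ((2 : ℤ) * N) := by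
    have h : (((tower 2 N (0 + 1) : ℕ) : ℤ)) = (2 : ℤ) * N := by simp [tower]
    rw [h] at hWP; exact hWP
  have hδs := isSkewDir_defect (d := 4) (by norm_num : 2 ≤ 2) hWu hx hs hWx N hw
  -- the difference is `−R₀ δ`
  have hdiff : (fun y ν => curvedLift (by norm_num) hWu hx hs hWx N hθ hE hw y ν - exactLift 2 N w y ν)
      = -(rightInvW0 (d := 4) (by norm_num) 0 hWu hx hs hWx N hθ hE hδs) := by
    funext y ν; simp only [curvedLift, Pi.neg_apply]; abel
  rw [hdiff, dirSq_neg]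
  -- R₀'s class letter
  have hR := dirSq_rightInvW0_class_le (d := 4) (by norm_num : 2 ≤ 2) 0 hWu hx hs hWx N hθ hE hWP hθl2 hε hδs (by norm_num)
  have hper : periodBox (d := 4) (N * 2 ^ (0 + 1)) = periodBox (d := 4) (2 * N) := by rw [show N * 2 ^ (0 + 1) = 2 * N by ring]
  rw [hper] at hR
  -- the defect letter: `δ = (cpush_W − cpush_1)(r w)`
  have hrP : IsPeriodicDir (exactLift 2 N w) ((2 : ℤ) * N) := fun z j κ' => by
    have h := exactLift_periodic (d := 4) (n := n) (by norm_num : 1 ≤ 2) N (fun y' j' κ'' => hwP y' j' κ'') z j κ'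
    rw [show (((2 * N : ℕ) : ℤ)) = (2 : ℤ) * N by push_cast; ring] at h
    exact h
  have hδeq : defect (L := 2) (W := W) N w = fun z κ => cpush 2 W (exactLift 2 N w) z κ - cpush 2 (flatCfg (d := 4) (n := n)) (exactLift 2 N w) z κ := by
    funext z κ
    simp only [defect]
    rw [cpush_exactLift (by norm_num : 1 ≤ 2) hN (fun y j κ => hwP y j κ)]
  have hD := dirSq_cpush_sub_cpush_flat_le (d := 4) (by norm_num : 1 ≤ 2) hN hWu hx h512 hWx hb hWb hrP
  rw [← hδeq] at hD
  -- the one-step flat letter (C) with `m = 1`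
  have hC := dirSq_liftIter_le (n := n) hN (fun y j κ => hwP y j κ) 1
  simp only [liftIter, pow_zero, one_mul, pow_one] at hC
  have hm0 : 0 ≤ dirSq w (periodBox (d := 4) N) := dirSq_nonneg _ _
  have hlm := liftMassC_nonneg 4 2
  have hdC := defC_nonneg 4 2
  have hA := defA_nonneg 4 2; have hB := defB_nonneg 4 2; have hK := Kmain_nonneg (n := n); have hDg := Dgauge_nonneg (n := n); have hρ := rho_nonneg
  calc dirSq (rightInvW0 (d := 4) (by norm_num) 0 hWu hx hs hWx N hθ hE hδs) (periodBox (d := 4) (2 * N))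
      ≤ ((((2 : ℕ) : ℝ) ^ (0 + 1)) ^ 4 / (((2 : ℕ) : ℝ) ^ (0 + 1)) ^ 2) * liftMassC 4 2 * dirSq (defect (L := 2) (W := W) N w) (periodBox (d := 4) N) := hR
    _ ≤ ((((2 : ℕ) : ℝ) ^ (0 + 1)) ^ 4 / (((2 : ℕ) : ℝ) ^ (0 + 1)) ^ 2) * liftMassC 4 2 * (defC 4 2 * (defA 4 2 * x + defB 4 2 * b) ^ 2 * dirSq (exactLift 2 N w) (periodBox (d := 4) (2 * N))) :=
        mul_le_mul_of_nonneg_left hD (by positivity)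
    _ ≤ ((((2 : ℕ) : ℝ) ^ (0 + 1)) ^ 4 / (((2 : ℕ) : ℝ) ^ (0 + 1)) ^ 2) * liftMassC 4 2
          * (defC 4 2 * (defA 4 2 * x + defB 4 2 * b) ^ 2 * ((Kmain n + Dgauge n) ^ 2 * rho ^ 2 * dirSq w (periodBox (d := 4) N))) := by
        refine mul_le_mul_of_nonneg_left (mul_le_mul_of_nonneg_left ?_ (by positivity)) (by positivity)
        simpa using hC
    _ = etaW n x b ^ 2 * dirSq w (periodBox (d := 4) N) := by
        unfold etaW
        rw [mul_pow, mul_pow, mul_pow, mul_pow, mul_pow, Real.sq_sqrt hlm, Real.sq_sqrt hdC]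
        norm_num
        ring

/-- **THE PERTURBATION LETTER, ROOT FORM**: `√dirSq (r_W w − r w) [0,2N)⁴ ≤ etaW(x,b)·√dirSq w [0,N)⁴`. [folklore] -/
theorem sqrt_dirSq_curvedLift_sub_exactLift_le (hWP : IsPeriodicCfg W ((tower 2 N (0 + 1) : ℕ) : ℤ))
    (hθl2 : thetaLoc 4 2 * ((((2 : ℕ) : ℝ) ^ (0 + 1)) ^ 2 * x) ≤ 1 / 2) (hε : (((2 : ℕ) : ℝ) ^ (0 + 1)) ^ 2 * x ≤ 1)
    {b : ℝ} (hb : 0 ≤ b) (hWb : ∀ (y : Site 4) (μ : Fin 4), ‖((W y μ : (Matrix n n ℂ)ˣ) : Matrix n n ℂ) - 1‖ ≤ b)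
    {w : Site 4 → Fin 4 → Matrix n n ℂ} (hw : IsSkewDir w) (hwP : IsPeriodicDir w (N : ℤ)) :
    Real.sqrt (dirSq (fun y ν => curvedLift (by norm_num) hWu hx hs hWx N hθ hE hw y ν - exactLift 2 N w y ν) (periodBox (d := 4) (2 * N)))
      ≤ etaW n x b * Real.sqrt (dirSq w (periodBox (d := 4) N)) :=
  sqrt_le_of_le_sq_mul (etaW_nonneg hx hb) (dirSq_curvedLift_sub_exactLift_le hWu hx hs hWx N hθ hE hWP hθl2 hε hb hWb hw hwP)

end Letter

end

end Summit.QuantumFields.BalabanUV.T4Continuum.NE7CurvedExactLift
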